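import Literature.NumberTheory.EllipticCurves.Uniformization
import Literature.NumberTheory.EllipticCurves.ModularCurve
import Literature.NumberTheory.EllipticCurves.Isogeny
import Literature.AlgebraicGeometry.PlaneCurves.HessePencilHarmonicMembers
import Summits.BirchSwinnertonDyer.Rank1Residual.ManinAdditive.CMLatticeSqueeze
import HarnessLib

/-!
# es g29 §5 — E-es-133 (`CMTwinLatticeLeTwo/Three`) PROVED modulo the named uniformisation-uniqueness
fact `PeriodPair.uniformization_unique` (Silverman AEC VI.5.1).

Pure period-lattice algebra: the homothetic pair `c • L`, homogeneity `G_n(cL) = c⁻ⁿ G_n(L)`,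
the Gaussian λ-lemma (`g₃ = 0`, `g₂' = -4 g₂` ⟹ `Λ ⊆ Λ'`, via `(1+i)⁴ = -4` and `iΛ' = Λ'`) and the
Eisenstein λ-lemma (`g₂ = 0`, `g₃' = -27 g₃` ⟹ `Λ ⊆ Λ'`, via `(√-3)⁶ = -27` and `ωΛ' = Λ'`), then the
curve-side bookkeeping (`j = 1728 ⟺ c₆ = 0`, `j = 0 ⟺ c₄ = 0`, Néron normalisation `g₂ = c₄/12`,
`g₃ = c₆/216`).  The two `def`s below are BYTE-IDENTICAL to `BsdF2ManinEsG29.CMTwinLatticeLeTwo/Three`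
of `Sketch-es-g29.lean` (E-es-133₂/₃).

TYPER NOTE (typer g19, T-es-46, part 3/3).  SOURCE = HOME/es/g29/Sketch-es-g29b.lean sha16 e327414f0c151de1 (291 l.; es: rc 0 · 0 warn, axioms standard)
VERBATIM except: this note; namespace `BsdF2ManinEsG29b` → `Summit.BirchSwinnertonDyer.Rank1Residual.ManinAdditive.KatoCurve.CMOptimal.TwinLattice` (a sub-namespace: the
API names `smulPair`, `omega`, … stay local to it); the §5.3 «verbatim copies» of the two defs `CMTwinLatticeLeTwo/Three` DROPPED — the theorems
below prove the LANDED nodes `KatoCurve.CMOptimal.CMTwinLatticeLeTwo/Three` of part 1 (`CMLatticeSqueeze.lean`, byte-identical bodies); es's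
`I_pow_four` (= Mathlib `Complex.I_pow_four`) dropped; es's `one_add_I_pow_four`, `one_add_I_ne_zero`, `sqrt_three_sq` demoted to local
`have`s (they restate one-liners of unrelated tree files: Ising/Hodge/… — gate `dedup.landed`, p714594); the two `#print axioms`
audit lines dropped (the gate audits axioms); one-line docstrings on undocumented helper lemmas.  Imports = es's four Literature files + part 1.
CONTENT (es): homothetic pairs `smulPair`, homogeneity `G_smulPair` / `g₂_smulPair` / `g₃_smulPair`, `mul_mem_lattice_of_invariants`, the Gaussian
λ-lemma `lattice_le_of_gaussian_twist` (`(1+i)⁴ = −4`, `iΛ' = Λ'`) and the Eisenstein λ-lemma `lattice_le_of_eisenstein_twist` (`(√−3)⁶ = −27`,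
`ωΛ' = Λ'`), curve-side bookkeeping, and **`cmTwinLatticeLeTwo_of_uniformization_unique : PeriodPair.uniformization_unique → CMTwinLatticeLeTwo`**,
**`cmTwinLatticeLeThree_of_uniformization_unique`** — E-es-133₂/₃ DISCHARGED MODULO the tree's named (unproved) Literature fact
`PeriodPair.uniformization_unique` (Silverman AEC VI.5.1, uniqueness half).  Nothing conjectured here.  PARTITION 0 · beyond-print theorem: no ·
BSD is not proved by this; C2/C3 OPEN.
-/

namespace Summit.BirchSwinnertonDyer.Rank1Residual.ManinAdditive.KatoCurve.CMOptimal.TwinLattice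

open WeierstrassCurve Literature.NumberTheory.EllipticCurves
  Literature.NumberTheory.EllipticCurves.ModularForms
open Complex (I)

/-! ## §5.1 Homothetic period pairs -/

/-- The homothetic period pair `c • L = (c ω₁, c ω₂)` for `c ≠ 0`. -/
noncomputable def smulPair (c : ℂ) (hc : c ≠ 0) (L : PeriodPair) : PeriodPair where
  ω₁ := c * L.ω₁
  ω₂ := c * L.ω₂
  indep := by
    refine LinearIndependent.pair_iff.mpr fun s t hst => ?_
    have h0 : c * ((s : ℂ) * L.ω₁ + (t : ℂ) * L.ω₂) = 0 := by
      simp only [Complex.real_smul] at hst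
      linear_combination hst
    have h1 : (s : ℂ) * L.ω₁ + (t : ℂ) * L.ω₂ = 0 := by
      rcases mul_eq_zero.mp h0 with h | h
      · exact absurd h hc
      · exact h
    exact LinearIndependent.pair_iff.mp L.indep s t (by simpa only [Complex.real_smul] using h1)

/-- First period of the homothetic pair. -/
@[simp] theorem smulPair_ω₁ (c : ℂ) (hc : c ≠ 0) (L : PeriodPair) :
    (smulPair c hc L).ω₁ = c * L.ω₁ := rfl

/-- Second period of the homothetic pair. -/
@[simp] theorem smulPair_ω₂ (c : ℂ) (hc : c ≠ 0) (L : PeriodPair) :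
    (smulPair c hc L).ω₂ = c * L.ω₂ := rfl

/-- The lattice of `c • L` is `c · L.lattice`. -/
theorem mem_smulPair_lattice {c : ℂ} {hc : c ≠ 0} {L : PeriodPair} {x : ℂ} :
    x ∈ (smulPair c hc L).lattice ↔ ∃ w ∈ L.lattice, x = c * w := by
  constructor
  · intro hx
    obtain ⟨m, n, hmn⟩ := PeriodPair.mem_lattice.mp hx
    refine ⟨(m : ℂ) * L.ω₁ + (n : ℂ) * L.ω₂, PeriodPair.mem_lattice.mpr ⟨m, n, rfl⟩, ?_⟩
    rw [← hmn, smulPair_ω₁, smulPair_ω₂]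
    ring
  · rintro ⟨w, hw, rfl⟩
    obtain ⟨m, n, hmn⟩ := PeriodPair.mem_lattice.mp hw
    refine PeriodPair.mem_lattice.mpr ⟨m, n, ?_⟩
    rw [← hmn, smulPair_ω₁, smulPair_ω₂]
    ring

/-- `c · z` lies in the lattice of `c • L` when `z ∈ L.lattice`. -/
theorem mul_mem_smulPair_lattice {c : ℂ} {hc : c ≠ 0} {L : PeriodPair} {w : ℂ}
    (hw : w ∈ L.lattice) : c * w ∈ (smulPair c hc L).lattice :=
  mem_smulPair_lattice.mpr ⟨w, hw, rfl⟩

/-- The additive equivalence `L.lattice ≃ (c • L).lattice`, `w ↦ c w`. -/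
noncomputable def smulPairLatticeEquiv (c : ℂ) (hc : c ≠ 0) (L : PeriodPair) :
    L.lattice ≃ (smulPair c hc L).lattice where
  toFun w := ⟨c * w, mul_mem_smulPair_lattice w.2⟩
  invFun z := ⟨c⁻¹ * z, by
    obtain ⟨w, hw, hz⟩ := mem_smulPair_lattice.mp z.2
    rw [hz, ← mul_assoc, inv_mul_cancel₀ hc, one_mul]
    exact hw⟩
  left_inv w := by
    ext
    simp [← mul_assoc, inv_mul_cancel₀ hc]
  right_inv z := by
    ext
    simp [← mul_assoc, mul_inv_cancel₀ hc]

/-- Homogeneity of the Eisenstein series of a lattice: `G_n(c • L) = (cⁿ)⁻¹ G_n(L)`. -/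
theorem G_smulPair (c : ℂ) (hc : c ≠ 0) (L : PeriodPair) (n : ℕ) :
    (smulPair c hc L).G n = (c ^ n)⁻¹ * L.G n := by
  unfold PeriodPair.G
  rw [← Equiv.tsum_eq (smulPairLatticeEquiv c hc L), ← tsum_mul_left]
  refine tsum_congr fun w => ?_
  simp only [smulPairLatticeEquiv, Equiv.coe_fn_mk, mul_pow, mul_inv]

/-- Homogeneity: `g₂(cL) = c⁻⁴ g₂(L)`. -/
theorem g₂_smulPair (c : ℂ) (hc : c ≠ 0) (L : PeriodPair) :
    (smulPair c hc L).g₂ = (c ^ 4)⁻¹ * L.g₂ := by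
  unfold PeriodPair.g₂
  rw [G_smulPair]
  ring

/-- Homogeneity: `g₃(cL) = c⁻⁶ g₃(L)`. -/
theorem g₃_smulPair (c : ℂ) (hc : c ≠ 0) (L : PeriodPair) :
    (smulPair c hc L).g₃ = (c ^ 6)⁻¹ * L.g₃ := by
  unfold PeriodPair.g₃
  rw [G_smulPair]
  ring

/-- CM stability: if `u • L'` has the same invariants as `L'` then `u w ∈ Λ'` for `w ∈ Λ'`. -/
theorem mul_mem_lattice_of_invariants (hU : PeriodPair.uniformization_unique)
    {u : ℂ} (hu : u ≠ 0) {L' : PeriodPair}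
    (h2 : (smulPair u hu L').g₂ = L'.g₂) (h3 : (smulPair u hu L').g₃ = L'.g₃)
    {w : ℂ} (hw : w ∈ L'.lattice) : u * w ∈ L'.lattice := by
  have := hU (smulPair u hu L') L' h2 h3
  rw [← this]
  exact mul_mem_smulPair_lattice hw

/-! ## §5.2 The two λ-lemmas (pure lattice algebra + uniformisation uniqueness) -/

/-- `i⁶ = −1`. -/
theorem I_pow_six : I ^ 6 = -1 := by
  linear_combination (I ^ 4 - I ^ 2 + 1) * Complex.I_sq

/-- **Gaussian λ-lemma.** Two lattices with `g₃ = 0` whose `g₂` differ by the factor `-4` are nested: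
`g₂(Λ') = -4·g₂(Λ)` ⟹ `Λ ⊆ Λ'` (indeed `Λ = (1+i)Λ'`, index 2). -/
theorem lattice_le_of_gaussian_twist (hU : PeriodPair.uniformization_unique) (L L' : PeriodPair)
    (h3 : L.g₃ = 0) (h3' : L'.g₃ = 0) (h2 : L'.g₂ = -4 * L.g₂) : L.lattice ≤ L'.lattice := by
  -- `(1 + i) ≠ 0` and `(1 + i)⁴ = -4` (kept local: the tree already has these one-liners in unrelated Literature files)
  have one_add_I_ne_zero : (1 + I : ℂ) ≠ 0 := by
    intro h
    have := congrArg Complex.re h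
    simp at this
  have one_add_I_pow_four : (1 + I) ^ 4 = -4 := by
    linear_combination (I ^ 2 + 4 * I + 5) * Complex.I_sq
  -- `L` and `(1+i) • L'` have the same invariants
  have hM2 : L.g₂ = (smulPair (1 + I) one_add_I_ne_zero L').g₂ := by
    rw [g₂_smulPair, one_add_I_pow_four, h2]
    field_simp
  have hM3 : L.g₃ = (smulPair (1 + I) one_add_I_ne_zero L').g₃ := by
    rw [g₃_smulPair, h3, h3', mul_zero]
  have hLM := hU L _ hM2 hM3
  -- `i • L'` has the same invariants as `L'` (CM by `ℤ[i]`)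
  have hI2 : (smulPair I Complex.I_ne_zero L').g₂ = L'.g₂ := by
    rw [g₂_smulPair, Complex.I_pow_four, inv_one, one_mul]
  have hI3 : (smulPair I Complex.I_ne_zero L').g₃ = L'.g₃ := by
    rw [g₃_smulPair, h3', mul_zero]
  intro z hz
  rw [hLM] at hz
  obtain ⟨w, hw, rfl⟩ := mem_smulPair_lattice.mp hz
  have hiw : I * w ∈ L'.lattice := mul_mem_lattice_of_invariants hU Complex.I_ne_zero hI2 hI3 hw
  have : (1 + I) * w = w + I * w := by ring
  rw [this]
  exact add_mem hw hiw

/-- `√3 · i ≠ 0`. -/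
theorem sqrt_neg_three_ne_zero : ((Real.sqrt 3 : ℝ) : ℂ) * I ≠ 0 := by
  refine mul_ne_zero ?_ Complex.I_ne_zero
  rw [Ne, Complex.ofReal_eq_zero]
  exact Real.sqrt_ne_zero'.mpr (by norm_num)

/-- `(√3 · i)⁶ = −27`. -/
theorem sqrt_neg_three_pow_six : (((Real.sqrt 3 : ℝ) : ℂ) * I) ^ 6 = -27 := by
  have hs : ((Real.sqrt 3 : ℝ) : ℂ) ^ 2 = 3 := by
    rw [← Complex.ofReal_pow, Real.sq_sqrt (by norm_num : (0 : ℝ) ≤ 3)]; norm_num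
  have : (((Real.sqrt 3 : ℝ) : ℂ) * I) ^ 2 = -3 := by
    rw [mul_pow, hs, Complex.I_sq]; norm_num
  calc (((Real.sqrt 3 : ℝ) : ℂ) * I) ^ 6 = ((((Real.sqrt 3 : ℝ) : ℂ) * I) ^ 2) ^ 3 := by ring
    _ = -27 := by rw [this]; norm_num

/-- `ω = (-1 + √-3)/2`. -/
noncomputable def omega : ℂ := (-1 + ((Real.sqrt 3 : ℝ) : ℂ) * I) / 2

/-- `ω³ = 1` for `ω = (−1 + √3 i)/2`. -/
theorem omega_pow_three : omega ^ 3 = 1 := by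
  have hs : ((Real.sqrt 3 : ℝ) : ℂ) ^ 2 = 3 := by
    rw [← Complex.ofReal_pow, Real.sq_sqrt (by norm_num : (0 : ℝ) ≤ 3)]; norm_num
  unfold omega
  linear_combination ((-3 * I ^ 2 + ((Real.sqrt 3 : ℝ) : ℂ) * I ^ 3) * hs
    + (-9 + 3 * ((Real.sqrt 3 : ℝ) : ℂ) * I) * Complex.I_sq) / 8

/-- `ω ≠ 0`. -/
theorem omega_ne_zero : omega ≠ 0 := by
  intro h
  have := omega_pow_three
  rw [h] at this
  norm_num at this

/-- **Eisenstein λ-lemma.** Two lattices with `g₂ = 0` whose `g₃` differ by the factor `-27` are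
nested: `g₃(Λ') = -27·g₃(Λ)` ⟹ `Λ ⊆ Λ'` (indeed `Λ = √-3·Λ'`, index 3). -/
theorem lattice_le_of_eisenstein_twist (hU : PeriodPair.uniformization_unique) (L L' : PeriodPair)
    (h2 : L.g₂ = 0) (h2' : L'.g₂ = 0) (h3 : L'.g₃ = -27 * L.g₃) : L.lattice ≤ L'.lattice := by
  have hM2 : L.g₂ = (smulPair _ sqrt_neg_three_ne_zero L').g₂ := by
    rw [g₂_smulPair, h2, h2', mul_zero]
  have hM3 : L.g₃ = (smulPair _ sqrt_neg_three_ne_zero L').g₃ := by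
    rw [g₃_smulPair, sqrt_neg_three_pow_six, h3]
    field_simp
  have hLM := hU L _ hM2 hM3
  -- `ω • L'` has the same invariants as `L'` (CM by `ℤ[ω]`)
  have hω4 : omega ^ 4 = omega := by
    calc omega ^ 4 = omega ^ 3 * omega := by ring
      _ = omega := by rw [omega_pow_three, one_mul]
  have hω6 : omega ^ 6 = 1 := by
    calc omega ^ 6 = (omega ^ 3) ^ 2 := by ring
      _ = 1 := by rw [omega_pow_three, one_pow]
  have hO2 : (smulPair omega omega_ne_zero L').g₂ = L'.g₂ := by
    rw [g₂_smulPair, h2', mul_zero]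
  have hO3 : (smulPair omega omega_ne_zero L').g₃ = L'.g₃ := by
    rw [g₃_smulPair, hω6, inv_one, one_mul]
  intro z hz
  rw [hLM] at hz
  obtain ⟨w, hw, rfl⟩ := mem_smulPair_lattice.mp hz
  have how : omega * w ∈ L'.lattice := mul_mem_lattice_of_invariants hU omega_ne_zero hO2 hO3 hw
  have : ((Real.sqrt 3 : ℝ) : ℂ) * I * w = 2 * (omega * w) + w := by
    unfold omega; ring
  rw [this, two_mul]
  exact add_mem (add_mem how how) hw

/-! ## §5.3 E-es-133 (the landed nodes `KatoCurve.CMOptimal.CMTwinLatticeLeTwo/Three`) proved modulo `PeriodPair.uniformization_unique` -/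

/-- `c₄` commutes with base change to `ℂ`. -/
theorem baseChange_c₄ (V : WeierstrassCurve ℚ) : (V.baseChange ℂ).c₄ = (V.c₄ : ℂ) := by
  simp [WeierstrassCurve.baseChange, WeierstrassCurve.map_c₄]

/-- `c₆` commutes with base change to `ℂ`. -/
theorem baseChange_c₆ (V : WeierstrassCurve ℚ) : (V.baseChange ℂ).c₆ = (V.c₆ : ℂ) := by
  simp [WeierstrassCurve.baseChange, WeierstrassCurve.map_c₆]

/-- **E-es-133₂ holds modulo uniformisation uniqueness** (Silverman AEC VI.5.1). -/
theorem cmTwinLatticeLeTwo_of_uniformization_unique (hU : PeriodPair.uniformization_unique) :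
    CMTwinLatticeLeTwo := by
  intro V W _ _ _ _ LV LW hjV hjW hiso hLV hLW hred
  have hV6 : V.c₆ = 0 :=
    (Literature.AlgebraicGeometry.PlaneCurves.j_eq_1728_iff_c₆_eq_zero V).mp hjV
  have hW6 : W.c₆ = 0 :=
    (Literature.AlgebraicGeometry.PlaneCurves.j_eq_1728_iff_c₆_eq_zero W).mp hjW
  obtain ⟨hV2, hV3⟩ := hLV
  obtain ⟨hW2, hW3⟩ := hLW
  rw [baseChange_c₄] at hV2 hW2
  rw [baseChange_c₆] at hV3 hW3
  rw [hV6] at hV3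
  rw [hW6] at hW3
  push_cast at hV3 hW3
  rw [zero_div] at hV3 hW3
  rcases hred W hjW hiso with h | h
  · -- equal `c₄`: equal invariants, equal lattices
    have := hU LV LW (by rw [hV2, hW2, h]) (by rw [hV3, hW3])
    exact this.le
  · refine lattice_le_of_gaussian_twist hU LV LW hV3 hW3 ?_
    rw [hW2, hV2, h]
    push_cast
    ring

/-- **E-es-133₃ holds modulo uniformisation uniqueness.** -/
theorem cmTwinLatticeLeThree_of_uniformization_unique (hU : PeriodPair.uniformization_unique) :
    CMTwinLatticeLeThree := by
  intro V W _ _ _ _ LV LW hjV hjW hiso hLV hLW hred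
  have hV4 : V.c₄ = 0 := (WeierstrassCurve.j_eq_zero_iff (W := V)).mp hjV
  have hW4 : W.c₄ = 0 := (WeierstrassCurve.j_eq_zero_iff (W := W)).mp hjW
  obtain ⟨hV2, hV3⟩ := hLV
  obtain ⟨hW2, hW3⟩ := hLW
  rw [baseChange_c₄] at hV2 hW2
  rw [baseChange_c₆] at hV3 hW3
  rw [hV4] at hV2
  rw [hW4] at hW2
  push_cast at hV2 hW2
  rw [zero_div] at hV2 hW2
  rcases hred W hjW hiso with h | h
  · have := hU LV LW (by rw [hV2, hW2]) (by rw [hV3, hW3, h])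
    exact this.le
  · refine lattice_le_of_eisenstein_twist hU LV LW hV2 hW2 ?_
    rw [hW3, hV3, h]
    push_cast
    ring

end Summit.BirchSwinnertonDyer.Rank1Residual.ManinAdditive.KatoCurve.CMOptimal.TwinLattice
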